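import Summits.QuantumFields.BalabanUV.Beta.ResolventPermutation

/-!
# `BalabanUV.Beta.ResolventPermutationStep` — road «FP» for binder row D1, row PERM-COV, MODULE 3: the axis permutations COMMUTE WITH
# BLOCK-CONTOUR DECIMATION (`permK_dec`), the decimated composite resolvents are permutation-invariant (`permK_KInvStep`), and the typed
# PERMUTATION LAW `B12Beta.PermCovariant (flipK (TbalOf Lc Js j))` of the step kernels follows from JET COVARIANCE (twin of
# `Beta.ResolventReflection` §5–§6)

HONEST FRAMING (cell contract, verbatim): «discharging `BetaPertH` makes Bałaban's UV stability UNCONDITIONAL — a real constructive-QFT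
result; it is NOT the continuum limit and NOT the Clay problem.»  THIS MODULE DISCHARGES NOTHING of `BetaPertH` / row D1: [folklore] finite
re-indexing of the decimation legs (`OneStepKernelFamily.dec`: block offsets permuted, the contour step carried to the permuted direction) over
MODULE 2's `permK_KInv`, and MODULE 1's unconditional Hessian law.  It proves the KERNEL-SIDE half of the permutation letter that the road FP
germ argument H2-G (`MarginalUniqueness.cubic_unique`'s `PermInvariant`) will consume next to the reflection rows, and REDUCES the letter for the
step kernels to two covariance properties of the jet data (binders, never facts):
(Sπ) `J.S (σ κ′) (σ•u) = permK (axisPerm σ) (J.S κ′ u)` and (Wπ) `J.W (σ μ) (σ•y) (σ ν) (σ•y′) = permK (axisPerm σ) (J.W μ y ν y′)`.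
CONTENT ([folklore], 0 sorry, 0 `def … : Prop`, nothing cited):
* §1 `legIdxPerm` (the index map of the decimation legs), `legPt_perm`, **`permK_dec : permK (axisPerm σ) (dec M K) = dec M (permK (axisPerm σ) K)`**
  (the SAME `σ` on both lattices — unlike the reflection, whose multiplier-leg map depends on the blocking), **`permK_KInvStep`**.
* §2 `colH_perm`, **`vertexOfK_perm`** (the chain-rule vertex through a permutation-invariant packed kernel is permutation-covariant for a
  permutation-covariant stencil family), `vertexOf_perm`.
* §3 ENDs: **`permCovariant_flipK_hessKer`** (any permutation-invariant `K`, raw families `S`, `W` — NO decay or localisation hypothesis is needed,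
  the relabelling identities of MODULE 1 being unconditional), `permCovariant_flipK_TOf`, `permCovariant_flipK_TstepOf`, and for the one-step family
  in dimension four **`permCovariant_flipK_TbalOf : (Sπ) → (Wπ) → ∀ j, PermCovariant (flipK (TbalOf Lc Js j))`**; `permCovariant_flipK_iff`.
NOT HERE: the jet covariances (Sπ)/(Wπ) for an1's averaging stencils ∕ tables and an3's Wilson tables (MODULE 4, the twins of
`WilsonJetReflection` ∕ `RootedJetReflection`); for the ROOTED objects note that the centred root `ctrOff (d+1) Lc` is permutation-FIXED.
Unit `b2b-balaban-beta-d1-formalise-leaf-01` (gen 7), 2026-08-20; claim table `HOME/b2b-balaban-beta-d1-p3/LEAVES-FP.md` sub-row PERM-COV.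
HONEST DEPENDENCY (verbatim): «continuum YM on T⁴ ⇐ BetaPertH ∧ nine spine estimates (0/9 proved); BetaPertH ⇐ (D1) ∧ (D4) ∧ CAP+tail;
G-an2-4 gates asym, D1 and NE2/3/4.»  ABSOLUTE RULE (cell, verbatim): «No internally-minted statement may enter as a cited fact. Every
hypothesis is either kernel-proved in this package or a verbatim quotation of a PUBLISHED theorem with page reference.»
-/

namespace Summit.QuantumFields.BalabanUV.Beta.ResolventPermutationStep

noncomputable section

open Finset
open scoped BigOperators
open Literature.MathematicalPhysics.QuantumFieldTheory.Balaban1983to89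
open Literature.MathematicalPhysics.QuantumFieldTheory.Balaban1983to89.Beta
open B12Beta (PermCovariant)
open AffineAveraging (box)
open ExpKernelCalculus (MKer hessKer)
open OneStepResolventKernel (Fib KInv vertexOf JetData TOf)
open OneStepKernelFamily (dec legSet legPt legW KInvStep colH vertexOfK vertexOfK_KInv TstepOf TbalOf flipK)
open ResolventReflection (mem_box mem_legSet_inl)
open Summit.QuantumFields.BalabanUV.Beta.KernelPermutation
open Summit.QuantumFields.BalabanUV.Beta.ResolventPermutation (psite_mem_box permK_KInv)

variable {d : ℕ}

/-! ## §1 The axis permutation commutes with block-contour decimation -/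

/-- [folklore] THE INDEX MAP of the decimation legs under the axis permutation `σ` (pull-back direction): block offsets are permuted by `σ⁻¹`,
the contour step is kept (it is carried to the permuted direction by `legPt`); multiplier legs carry a single index. -/
def legIdxPerm (σ : Equiv.Perm (Fin (d + 1))) : Fib d → ((Fin (d + 1) → ℕ) × ℕ) → ((Fin (d + 1) → ℕ) × ℕ)
  | Sum.inl _, i => (psite σ⁻¹ i.1, i.2)
  | Sum.inr _, i => i

/-- [folklore] THE INVERSE INDEX MAP. -/
def legIdxUnperm (σ : Equiv.Perm (Fin (d + 1))) : Fib d → ((Fin (d + 1) → ℕ) × ℕ) → ((Fin (d + 1) → ℕ) × ℕ)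
  | Sum.inl _, i => (psite σ i.1, i.2)
  | Sum.inr _, i => i

/-- [folklore] The leg index sets do not see the leg-type relabelling. -/
theorem legSet_π (σ : Equiv.Perm (Fin (d + 1))) (M : ℕ) (a : Fib d) : legSet d M ((axisPerm σ).π a) = legSet d M a := by
  cases a <;> rfl

/-- [folklore] The leg weights do not see the leg-type relabelling. -/
theorem legW_π (σ : Equiv.Perm (Fin (d + 1))) (M : ℕ) (a : Fib d) : legW d M ((axisPerm σ).π a) = legW d M a := by
  cases a <;> rfl

/-- [folklore] The index map preserves the leg index sets. -/
theorem legIdxPerm_mem (σ : Equiv.Perm (Fin (d + 1))) {M : ℕ} {a : Fib d} {i : (Fin (d + 1) → ℕ) × ℕ} (hi : i ∈ legSet d M a) :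
    legIdxPerm σ a i ∈ legSet d M a := by
  rcases a with κ | κ
  · obtain ⟨hr, hs⟩ := mem_legSet_inl.1 hi
    exact mem_legSet_inl.2 ⟨psite_mem_box σ⁻¹ hr, hs⟩
  · exact hi

/-- [folklore] The inverse index map preserves the leg index sets. -/
theorem legIdxUnperm_mem (σ : Equiv.Perm (Fin (d + 1))) {M : ℕ} {a : Fib d} {i : (Fin (d + 1) → ℕ) × ℕ} (hi : i ∈ legSet d M a) :
    legIdxUnperm σ a i ∈ legSet d M a := by
  rcases a with κ | κ
  · obtain ⟨hr, hs⟩ := mem_legSet_inl.1 hi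
    exact mem_legSet_inl.2 ⟨psite_mem_box σ hr, hs⟩
  · exact hi

/-- [folklore] `legIdxUnperm ∘ legIdxPerm = id`. -/
theorem legIdxUnperm_legIdxPerm (σ : Equiv.Perm (Fin (d + 1))) (a : Fib d) (i : (Fin (d + 1) → ℕ) × ℕ) :
    legIdxUnperm σ a (legIdxPerm σ a i) = i := by
  rcases a with κ | κ
  · simp only [legIdxPerm, legIdxUnperm, psite_psite_inv]
  · rfl

/-- [folklore] `legIdxPerm ∘ legIdxUnperm = id`. -/
theorem legIdxPerm_legIdxUnperm (σ : Equiv.Perm (Fin (d + 1))) (a : Fib d) (i : (Fin (d + 1) → ℕ) × ℕ) :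
    legIdxPerm σ a (legIdxUnperm σ a i) = i := by
  rcases a with κ | κ
  · simp only [legIdxPerm, legIdxUnperm, psite_inv_psite]
  · rfl

/-- [folklore] **THE LEG POINTS ARE EQUIVARIANT**: the leg point of index `i` of the relabelled leg over the permuted step point is the permuted
leg point of the pulled-back index over the step point. -/
theorem legPt_perm (σ : Equiv.Perm (Fin (d + 1))) (M : ℕ) (a : Fib d) (x' : Fin (d + 1) → ℤ) (i : (Fin (d + 1) → ℕ) × ℕ) :
    legPt M ((axisPerm σ).π a) (psite σ x') i = psite σ (legPt M a x' (legIdxPerm σ a i)) := by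
  rcases a with κ | κ
  · simp only [axisPerm_π_inl, legPt, legIdxPerm, psite_add, psite_smul]
    congr 1
    funext j
    simp only [psite_apply, Equiv.Perm.inv_def, Equiv.symm_symm, Equiv.apply_symm_apply, Equiv.symm_apply_eq]
  · simp only [axisPerm_π_inr, legPt, psite_smul]

/-- [folklore] **THE AXIS PERMUTATION COMMUTES WITH BLOCK-CONTOUR DECIMATION**: `permK (axisPerm σ) (dec M K) = dec M (permK (axisPerm σ) K)`. -/
theorem permK_dec (σ : Equiv.Perm (Fin (d + 1))) (M : ℕ) (K : MKer (d + 1) (Fib d)) :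
    permK (axisPerm σ) (dec M K) = dec M (permK (axisPerm σ) K) := by
  funext x' y' a b
  rw [permK_axisPerm_apply]
  simp only [dec]
  rw [legSet_π, legSet_π, legW_π, legW_π]
  refine Finset.sum_nbij' (legIdxPerm σ a) (legIdxUnperm σ a) (fun _ hi => legIdxPerm_mem σ hi) (fun _ hi => legIdxUnperm_mem σ hi)
    (fun i _ => legIdxUnperm_legIdxPerm σ a i) (fun i _ => legIdxPerm_legIdxUnperm σ a i) (fun i _ => ?_)
  refine Finset.sum_nbij' (legIdxPerm σ b) (legIdxUnperm σ b) (fun _ hi => legIdxPerm_mem σ hi) (fun _ hi => legIdxUnperm_mem σ hi)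
    (fun i' _ => legIdxUnperm_legIdxPerm σ b i') (fun i' _ => legIdxPerm_legIdxUnperm σ b i') (fun i' _ => ?_)
  rw [permK_axisPerm_apply, legPt_perm, legPt_perm]

/-- [folklore] **THE DECIMATED COMPOSITE RESOLVENTS ARE PERMUTATION-INVARIANT**: `permK (axisPerm σ) (KInvStep Lc j) = KInvStep Lc j` — every `σ`,
every step `j`, every `Lc ≥ 1`, any dimension. -/
theorem permK_KInvStep {Lc : ℕ} [NeZero Lc] (σ : Equiv.Perm (Fin (d + 1))) (j : ℕ) :
    permK (axisPerm σ) (KInvStep (d := d) Lc j) = KInvStep (d := d) Lc j := by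
  unfold KInvStep
  rw [permK_dec, permK_KInv]

/-! ## §2 Permutation covariance of the `ℋ`-column and of the chain-rule vertex -/

section Vertex

variable {N : ℕ} {σ : Equiv.Perm (Fin (d + 1))}

/-- [folklore] **PERMUTATION INVARIANCE OF THE `ℋ`-COLUMN** of a permutation-invariant packed kernel. -/
theorem colH_perm {K : MKer (d + 1) (Fib d)} (hK : permK (axisPerm σ) K = K) (μ : Fin (d + 1)) (y : Fin (d + 1) → ℤ)
    (κ' : Fin (d + 1)) (u : Fin (d + 1) → ℤ) : colH K N (σ μ) (psite σ y) (σ κ') (psite σ u) = colH K N μ y κ' u := by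
  simp only [colH]
  conv_rhs => rw [← hK]
  rw [permK_axisPerm_apply, axisPerm_π_inl, axisPerm_π_inr, psite_smul]

/-- [folklore] **PERMUTATION COVARIANCE OF THE CHAIN-RULE VERTEX** through a permutation-invariant packed kernel, for a permutation-covariant
stencil family: `V (σ μ) (σ•y) = permK (axisPerm σ) (V μ y)` — the hypothesis `hVr` of `KernelPermutation.hessKer_perm`. -/
theorem vertexOfK_perm {K : MKer (d + 1) (Fib d)} (hK : permK (axisPerm σ) K = K)
    {S : Fin (d + 1) → (Fin (d + 1) → ℤ) → MKer (d + 1) (Fib d)} (hS : ∀ κ' u, S (σ κ') (psite σ u) = permK (axisPerm σ) (S κ' u))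
    (μ : Fin (d + 1)) (y : Fin (d + 1) → ℤ) : vertexOfK K N S (σ μ) (psite σ y) = permK (axisPerm σ) (vertexOfK K N S μ y) := by
  funext x z a b
  simp only [vertexOfK, OneStepResolventKernel.wsum, permK_axisPerm_apply]
  calc ∑ κ', ∑' u, colH K N (σ μ) (psite σ y) κ' u * S κ' u x z a b
      = ∑ κ', ∑' u, colH K N (σ μ) (psite σ y) (σ κ') u * S (σ κ') u x z a b :=
        (Equiv.sum_comp σ (fun κ' => ∑' u, colH K N (σ μ) (psite σ y) κ' u * S κ' u x z a b)).symm
    _ = ∑ κ', ∑' u, colH K N (σ μ) (psite σ y) (σ κ') (psite σ u) * S (σ κ') (psite σ u) x z a b :=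
        Finset.sum_congr rfl fun κ' _ =>
          (Equiv.tsum_eq (psite σ) (fun u => colH K N (σ μ) (psite σ y) (σ κ') u * S (σ κ') u x z a b)).symm
    _ = ∑ κ', ∑' u, colH K N μ y κ' u * S κ' u (psite σ x) (psite σ z) ((axisPerm σ).π a) ((axisPerm σ).π b) := by
        refine Finset.sum_congr rfl fun κ' _ => tsum_congr fun u => ?_
        rw [colH_perm hK, hS]
        rfl

/-- [folklore] The same for the one-step chain-rule vertex `OneStepResolventKernel.vertexOf` (through `KInv`). -/
theorem vertexOf_perm [NeZero N] (σ : Equiv.Perm (Fin (d + 1)))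
    {S : Fin (d + 1) → (Fin (d + 1) → ℤ) → MKer (d + 1) (Fib d)} (hS : ∀ κ' u, S (σ κ') (psite σ u) = permK (axisPerm σ) (S κ' u))
    (μ : Fin (d + 1)) (y : Fin (d + 1) → ℤ) :
    vertexOf (N := N) S (σ μ) (psite σ y) = permK (axisPerm σ) (vertexOf (N := N) S μ y) := by
  rw [← vertexOfK_KInv, ← vertexOfK_KInv]
  exact vertexOfK_perm (permK_KInv σ) hS μ y

end Vertex

/-! ## §3 The typed permutation law of the resolvent Hessian kernels from jet covariance -/

section Hessian

variable {N : ℕ}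

/-- [folklore] `PermCovariant` of a kernel and of its flip are equivalent (`σ•(−z) = −(σ•z)`). -/
theorem permCovariant_flipK_iff {D : ℕ} (T : Fin D → Fin D → (Fin D → ℤ) → ℝ) : PermCovariant (flipK T) ↔ PermCovariant T := by
  constructor
  · intro h
    have h' := permCovariant_flip h
    simpa only [flipK, neg_neg] using h'
  · exact fun h => permCovariant_flip h

/-- [folklore] **THE TYPED PERMUTATION LAW OF A RESOLVENT HESSIAN KERNEL, FROM JET COVARIANCE.**  For ANY packed kernel `K` invariant under every
axis permutation and ANY stencil ∕ second-order families with (Sπ) `S (σ κ′) (σ•u) = σ·(S κ′ u)`, (Wπ) `W (σ μ) (σ•y) (σ ν) (σ•y′) = σ·(W μ y ν y′)`,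
the flipped resolvent Hessian kernel satisfies `B12Beta.PermCovariant` VERBATIM.  No decay ∕ localisation hypothesis. -/
theorem permCovariant_flipK_hessKer {K : MKer (d + 1) (Fib d)} (hK : ∀ σ : Equiv.Perm (Fin (d + 1)), permK (axisPerm σ) K = K)
    {S : Fin (d + 1) → (Fin (d + 1) → ℤ) → MKer (d + 1) (Fib d)}
    {W : Fin (d + 1) → (Fin (d + 1) → ℤ) → Fin (d + 1) → (Fin (d + 1) → ℤ) → MKer (d + 1) (Fib d)}
    (hS : ∀ (σ : Equiv.Perm (Fin (d + 1))) (κ' : Fin (d + 1)) (u : Fin (d + 1) → ℤ), S (σ κ') (psite σ u) = permK (axisPerm σ) (S κ' u))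
    (hW : ∀ (σ : Equiv.Perm (Fin (d + 1))) (μ : Fin (d + 1)) (y : Fin (d + 1) → ℤ) (ν : Fin (d + 1)) (y' : Fin (d + 1) → ℤ),
      W (σ μ) (psite σ y) (σ ν) (psite σ y') = permK (axisPerm σ) (W μ y ν y')) :
    PermCovariant (flipK (hessKer K (vertexOfK K N S) W)) :=
  permCovariant_flip_hessKer fun σ => ⟨axisPerm σ, hK σ, fun μ y => vertexOfK_perm (hK σ) (hS σ) μ y, hW σ⟩

/-- [folklore] **THE ONE-SHOT ∕ ONE-STEP-AT-`j = 0` CASE**: `PermCovariant (flipK (TOf J))` for a jet datum over the typed `U = 1` system with (Sπ)/(Wπ)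
— every `N ≥ 1`, any dimension; the kernel-side input `permK_KInv` is MODULE 2's theorem. -/
theorem permCovariant_flipK_TOf [NeZero N] (J : JetData d N)
    (hS : ∀ (σ : Equiv.Perm (Fin (d + 1))) (κ' : Fin (d + 1)) (u : Fin (d + 1) → ℤ), J.S (σ κ') (psite σ u) = permK (axisPerm σ) (J.S κ' u))
    (hW : ∀ (σ : Equiv.Perm (Fin (d + 1))) (μ : Fin (d + 1)) (y : Fin (d + 1) → ℤ) (ν : Fin (d + 1)) (y' : Fin (d + 1) → ℤ),
      J.W (σ μ) (psite σ y) (σ ν) (psite σ y') = permK (axisPerm σ) (J.W μ y ν y')) :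
    PermCovariant (flipK (TOf (N := N) J)) := by
  have h := permCovariant_flipK_hessKer (N := N) (fun σ => permK_KInv (N := N) (d := d) σ) hS hW
  have e : vertexOfK (KInv (N := N) (d := d)) N J.S = vertexOf (N := N) J.S :=
    funext fun μ => funext fun y => vertexOfK_KInv J.S μ y
  rw [e] at h
  exact h

/-- [folklore] **THE GENUINE STEP-`j` KERNEL**: `PermCovariant (flipK (TstepOf Lc j J))` from (Sπ)/(Wπ) — the kernel-side input `permK_KInvStep`. -/
theorem permCovariant_flipK_TstepOf {Lc : ℕ} [NeZero Lc] (j : ℕ) (J : JetData d Lc)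
    (hS : ∀ (σ : Equiv.Perm (Fin (d + 1))) (κ' : Fin (d + 1)) (u : Fin (d + 1) → ℤ), J.S (σ κ') (psite σ u) = permK (axisPerm σ) (J.S κ' u))
    (hW : ∀ (σ : Equiv.Perm (Fin (d + 1))) (μ : Fin (d + 1)) (y : Fin (d + 1) → ℤ) (ν : Fin (d + 1)) (y' : Fin (d + 1) → ℤ),
      J.W (σ μ) (psite σ y) (σ ν) (psite σ y') = permK (axisPerm σ) (J.W μ y ν y')) :
    PermCovariant (flipK (TstepOf Lc j J)) := by
  unfold TstepOf
  exact permCovariant_flipK_hessKer (fun σ => permK_KInvStep σ j) hS hW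

/-- [folklore] **THE PERMUTATION LETTER OF THE ONE-STEP FAMILY FROM JET COVARIANCE** (dimension four): if every step jet datum `Js j` has (Sπ) and (Wπ),
then `∀ j, PermCovariant (flipK (TbalOf Lc Js j))` — all kernel-side content discharged here; the jet covariances are HYPOTHESES. -/
theorem permCovariant_flipK_TbalOf {Lc : ℕ} [NeZero Lc] (Js : ℕ → JetData 3 Lc)
    (hS : ∀ (j : ℕ) (σ : Equiv.Perm (Fin 4)) (κ' : Fin 4) (u : Fin 4 → ℤ), (Js j).S (σ κ') (psite σ u) = permK (axisPerm σ) ((Js j).S κ' u))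
    (hW : ∀ (j : ℕ) (σ : Equiv.Perm (Fin 4)) (μ : Fin 4) (y : Fin 4 → ℤ) (ν : Fin 4) (y' : Fin 4 → ℤ),
      (Js j).W (σ μ) (psite σ y) (σ ν) (psite σ y') = permK (axisPerm σ) ((Js j).W μ y ν y')) :
    ∀ j : ℕ, PermCovariant (flipK (TbalOf Lc Js j)) :=
  fun j => permCovariant_flipK_TstepOf j (Js j) (hS j) (hW j)

end Hessian

end

end Summit.QuantumFields.BalabanUV.Beta.ResolventPermutationStep
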